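import Summits.Schanuel.Schanuel.Theorems.ZilberEacExplosionDensity
import HarnessLib

/-!
# The explosion regime: further certified members with dense exponential points

Zilber's Exponential-Algebraic Closedness, case ladder (host summit Schanuel, cell `pub-schanuel`,
seat 2, gen 10).  Two more instances of `unprojectedDense_polyFibredGraph_balance` /
`polyFibredGraph_balance_member_dense` (`ZilberEacExplosionDensity`), chosen to exercise the two
parameters the flagship `negSumSquares_member_dense` does not: UNEQUAL fibre degrees (slope
`λ = e₁/e₀ = 2`, balance direction `(1,2)`) and a HIGHER-dimensional cell (`EC(4,3)`, `s = 2`):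

* `negSumSquares_sq_member_dense` — `{x₂ = -(x₀² + x₁²), y₀ = x₀ + y₂, y₁ = x₁ + y₂³}` ⊆ ℂ³×ℂ³
  (`e^z = z + e^{-(z²+w²)}`, `e^w = w + e^{-3(z²+w²)}`; `e = (1,3)`, `g_D(1,3) = -10 ≠ 0`): certified
  member of `EC(3,2)`, not linearly split, meets `Γ_exp`, dense;
* `negSumThreeSquares_member_dense` — the 4-fold `{x₃ = -(x₀² + x₁² + x₂²), yⱼ = xⱼ + y₃}`
  ⊆ ℂ⁴×ℂ⁴ (`e^{xⱼ} = xⱼ + e^{-(x₀²+x₁²+x₂²)}`, `j = 0,1,2`; `g_D(1,1,1) = -3`): certified member of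
  `EC(4,3)`, dense.

HONEST FRAMING: explicit members of OPEN cells; EC(3,2), EC(4,3) OPEN; NOT Schanuel's conjecture;
EAC ⇏ SC.
-/

noncomputable section

open Complex MvPolynomial Filter Topology
open Literature.NumberTheory.Transcendental Literature.ModelTheory.Zilber
  Literature.ModelTheory.ExponentialFields

set_option linter.dupNamespace false

namespace Summit.Schanuel.Schanuel.Theorems

section Examples

/-- `aeval X` is the identity, hence injective (the diagonal targets `Aⱼ = Xⱼ` are dominant).
[folklore] -/
theorem aeval_X_injective_fin (n : ℕ) :
    Function.Injective (aeval (fun j : Fin n => (X j : MvPolynomial (Fin n) ℂ)) :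
      MvPolynomial (Fin n) ℂ →ₐ[ℂ] MvPolynomial (Fin n) ℂ) := by
  rw [aeval_X_left]; exact fun _ _ h => h

/-- **Unequal fibre degrees**: `{x₂ = -(x₀² + x₁²), y₀ = x₀ + y₂, y₁ = x₁ + y₂³}` (fibre
polynomials `f₀ = 1`, `f₁ = u²`; balance direction `e = (1,3)`, `g_D(1,3) = -10`) is a certified
member of `EC(3,2)`, not linearly split, meets `Γ_exp` and has Zariski dense exponential points.
(new) [cite: MantovaMasser2023, §1 p.5 (the open case dim π(V) = 2 in ℂ³×ℂˣ³)] -/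
theorem negSumSquares_sq_member_dense :
    (IsIrreducibleClosed ℂ (polyFibredGraph (-(X 0 ^ 2 + X 1 ^ 2) : MvPolynomial (Fin 2) ℂ)
        (fun j => X j) (fun j => ((![1, Polynomial.X ^ 2] : Fin 2 → Polynomial ℂ) j).toMvPolynomial 0)) ∧
      (polyFibredGraph (-(X 0 ^ 2 + X 1 ^ 2) : MvPolynomial (Fin 2) ℂ) (fun j => X j)
          (fun j => ((![1, Polynomial.X ^ 2] : Fin 2 → Polynomial ℂ) j).toMvPolynomial 0) ∩
        torusLocus ℂ 3).Nonempty ∧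
      IsRotund ℂ 3 (polyFibredGraph (-(X 0 ^ 2 + X 1 ^ 2) : MvPolynomial (Fin 2) ℂ) (fun j => X j)
          (fun j => ((![1, Polynomial.X ^ 2] : Fin 2 → Polynomial ℂ) j).toMvPolynomial 0) ∩
        torusLocus ℂ 3) ∧
      IsAddFree ℂ 3 (polyFibredGraph (-(X 0 ^ 2 + X 1 ^ 2) : MvPolynomial (Fin 2) ℂ) (fun j => X j)
          (fun j => ((![1, Polynomial.X ^ 2] : Fin 2 → Polynomial ℂ) j).toMvPolynomial 0) ∩
        torusLocus ℂ 3) ∧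
      IsMulFree ℂ 3 (polyFibredGraph (-(X 0 ^ 2 + X 1 ^ 2) : MvPolynomial (Fin 2) ℂ) (fun j => X j)
          (fun j => ((![1, Polynomial.X ^ 2] : Fin 2 → Polynomial ℂ) j).toMvPolynomial 0) ∩
        torusLocus ℂ 3) ∧
      zariskiDim ℂ (polyFibredGraph (-(X 0 ^ 2 + X 1 ^ 2) : MvPolynomial (Fin 2) ℂ) (fun j => X j)
          (fun j => ((![1, Polynomial.X ^ 2] : Fin 2 → Polynomial ℂ) j).toMvPolynomial 0)) = (3 : ℕ) ∧
      addProjDim ℂ 3 (polyFibredGraph (-(X 0 ^ 2 + X 1 ^ 2) : MvPolynomial (Fin 2) ℂ) (fun j => X j)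
          (fun j => ((![1, Polynomial.X ^ 2] : Fin 2 → Polynomial ℂ) j).toMvPolynomial 0)) = (2 : ℕ)) ∧
    ¬ IsLinearSplit ℂ 3 (polyFibredGraph (-(X 0 ^ 2 + X 1 ^ 2) : MvPolynomial (Fin 2) ℂ)
        (fun j => X j) (fun j => ((![1, Polynomial.X ^ 2] : Fin 2 → Polynomial ℂ) j).toMvPolynomial 0)) ∧
    (polyFibredGraph (-(X 0 ^ 2 + X 1 ^ 2) : MvPolynomial (Fin 2) ℂ) (fun j => X j)
        (fun j => ((![1, Polynomial.X ^ 2] : Fin 2 → Polynomial ℂ) j).toMvPolynomial 0) ∩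
        expGraph ℂ 3).Nonempty ∧
    UnprojectedDense (polyFibredGraph (-(X 0 ^ 2 + X 1 ^ 2) : MvPolynomial (Fin 2) ℂ)
        (fun j => X j) (fun j => ((![1, Polynomial.X ^ 2] : Fin 2 → Polynomial ℂ) j).toMvPolynomial 0)) := by
  set g : MvPolynomial (Fin 2) ℂ := -(X 0 ^ 2 + X 1 ^ 2) with hg
  have hhom : g.IsHomogeneous 2 := ((isHomogeneous_X_pow 0 2).add (isHomogeneous_X_pow 1 2)).neg
  have heval : ∀ x : Fin 2 → ℂ, eval x g = -(x 0 ^ 2 + x 1 ^ 2) := fun x => by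
    simp [hg, map_add, map_pow, eval_X]
  have hg0 : g ≠ 0 := by
    intro h
    have := heval ![1, 0]
    rw [h, map_zero] at this
    norm_num at this
  have hdeg : g.totalDegree = 2 := hhom.totalDegree hg0
  have hf : ∀ j : Fin 2, (![1, Polynomial.X ^ 2] : Fin 2 → Polynomial ℂ) j ≠ 0 := by
    intro j; fin_cases j
    · exact one_ne_zero
    · exact pow_ne_zero _ Polynomial.X_ne_zero
  have hdir : eval (fun j : Fin 2 =>
      ((((![1, Polynomial.X ^ 2] : Fin 2 → Polynomial ℂ) j).natDegree + 1 : ℕ) : ℂ))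
      (homogeneousComponent g.totalDegree g) ≠ 0 := by
    rw [hdeg, homogeneousComponent_eq_self hhom, heval]
    simp only [Matrix.cons_val_zero, Matrix.cons_val_one, Polynomial.natDegree_one,
      Polynomial.natDegree_pow, Polynomial.natDegree_X]
    norm_num
  exact polyFibredGraph_balance_member_dense g (by rw [hdeg]) _ (aeval_X_injective_fin 2) _ hf hdir

/-- The unequal-degree system is solvable: `∃ z w, e^z = z + e^{-(z²+w²)} ∧ e^w = w + e^{-3(z²+w²)}`.
(new) [cite: MantovaMasser2023, §1 p.5 (the open case dim π(V) = 2 in ℂ³×ℂˣ³)] -/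
theorem exists_exp_eq_self_add_exp_neg_sum_sq_cube :
    ∃ z w : ℂ, exp z = z + exp (-(z ^ 2 + w ^ 2)) ∧ exp w = w + exp (-(3 * (z ^ 2 + w ^ 2))) := by
  obtain ⟨-, -, ⟨p, hp, hexp⟩, -⟩ := negSumSquares_sq_member_dense
  rw [mem_polyFibredGraph_iff] at hp
  rw [mem_expGraph_iff] at hexp
  obtain ⟨hbase, hfib⟩ := hp
  have e0 := hexp (Fin.castSucc (0 : Fin 2))
  have e1 := hexp (Fin.castSucc (1 : Fin 2))
  have e2 := hexp (Fin.last 2)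
  rw [ExponentialRing.complex_exp_eq] at e0 e1 e2
  have h0 := hfib 0
  have h1 := hfib 1
  simp only [map_neg, map_add, map_pow, eval_X, Matrix.cons_val_zero, Matrix.cons_val_one,
    map_one, mul_one, MvPolynomial.eval_toMvPolynomial, Fin.cons_zero, Polynomial.eval_X] at h0 h1 hbase
  refine ⟨p (Sum.inl (Fin.castSucc (0 : Fin 2))), p (Sum.inl (Fin.castSucc (1 : Fin 2))), ?_, ?_⟩
  · rw [← e0, h0, e2, hbase]
  · rw [← e1, h1, e2, hbase]
    have h3 : exp (-(p (Sum.inl (Fin.castSucc (0 : Fin 2))) ^ 2 + p (Sum.inl (Fin.castSucc (1 : Fin 2))) ^ 2)) *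
        exp (-(p (Sum.inl (Fin.castSucc (0 : Fin 2))) ^ 2 + p (Sum.inl (Fin.castSucc (1 : Fin 2))) ^ 2)) ^ 2 =
        exp (-(3 * (p (Sum.inl (Fin.castSucc (0 : Fin 2))) ^ 2 +
          p (Sum.inl (Fin.castSucc (1 : Fin 2))) ^ 2))) := by
      rw [← pow_succ', ← Complex.exp_nat_mul]
      congr 1
      push_cast
      ring
    rw [h3]

/-- **A member of `EC(4,3)`** (`s = 2`): the 4-fold `{x₃ = -(x₀² + x₁² + x₂²), yⱼ = xⱼ + y₃ (j ≤ 2)}`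
⊆ ℂ⁴ × ℂ⁴ (`e^{xⱼ} = xⱼ + e^{-(x₀²+x₁²+x₂²)}`; balance direction `(1,1,1)`, `g_D(1,1,1) = -3`):
all seven hypotheses of `ECCell 4 3`, not linearly split, meets `Γ_exp`, dense exponential points.
(new) [cite: MantovaMasser2023, §1 p.5 (the open case dim π(V) = 2 in ℂ³×ℂˣ³)] -/
theorem negSumThreeSquares_member_dense :
    (IsIrreducibleClosed ℂ (polyFibredGraph (-(X 0 ^ 2 + X 1 ^ 2 + X 2 ^ 2) : MvPolynomial (Fin 3) ℂ)
        (fun j => X j) (fun _ => 1)) ∧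
      (polyFibredGraph (-(X 0 ^ 2 + X 1 ^ 2 + X 2 ^ 2) : MvPolynomial (Fin 3) ℂ) (fun j => X j)
          (fun _ => 1) ∩ torusLocus ℂ 4).Nonempty ∧
      IsRotund ℂ 4 (polyFibredGraph (-(X 0 ^ 2 + X 1 ^ 2 + X 2 ^ 2) : MvPolynomial (Fin 3) ℂ)
          (fun j => X j) (fun _ => 1) ∩ torusLocus ℂ 4) ∧
      IsAddFree ℂ 4 (polyFibredGraph (-(X 0 ^ 2 + X 1 ^ 2 + X 2 ^ 2) : MvPolynomial (Fin 3) ℂ)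
          (fun j => X j) (fun _ => 1) ∩ torusLocus ℂ 4) ∧
      IsMulFree ℂ 4 (polyFibredGraph (-(X 0 ^ 2 + X 1 ^ 2 + X 2 ^ 2) : MvPolynomial (Fin 3) ℂ)
          (fun j => X j) (fun _ => 1) ∩ torusLocus ℂ 4) ∧
      zariskiDim ℂ (polyFibredGraph (-(X 0 ^ 2 + X 1 ^ 2 + X 2 ^ 2) : MvPolynomial (Fin 3) ℂ)
          (fun j => X j) (fun _ => 1)) = (4 : ℕ) ∧
      addProjDim ℂ 4 (polyFibredGraph (-(X 0 ^ 2 + X 1 ^ 2 + X 2 ^ 2) : MvPolynomial (Fin 3) ℂ)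
          (fun j => X j) (fun _ => 1)) = (3 : ℕ)) ∧
    ¬ IsLinearSplit ℂ 4 (polyFibredGraph (-(X 0 ^ 2 + X 1 ^ 2 + X 2 ^ 2) : MvPolynomial (Fin 3) ℂ)
        (fun j => X j) (fun _ => 1)) ∧
    (polyFibredGraph (-(X 0 ^ 2 + X 1 ^ 2 + X 2 ^ 2) : MvPolynomial (Fin 3) ℂ) (fun j => X j)
        (fun _ => 1) ∩ expGraph ℂ 4).Nonempty ∧
    UnprojectedDense (polyFibredGraph (-(X 0 ^ 2 + X 1 ^ 2 + X 2 ^ 2) : MvPolynomial (Fin 3) ℂ)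
        (fun j => X j) (fun _ => 1)) := by
  set g : MvPolynomial (Fin 3) ℂ := -(X 0 ^ 2 + X 1 ^ 2 + X 2 ^ 2) with hg
  have hhom : g.IsHomogeneous 2 :=
    (((isHomogeneous_X_pow 0 2).add (isHomogeneous_X_pow 1 2)).add (isHomogeneous_X_pow 2 2)).neg
  have heval : ∀ x : Fin 3 → ℂ, eval x g = -(x 0 ^ 2 + x 1 ^ 2 + x 2 ^ 2) := fun x => by
    simp [hg, map_add, map_pow, eval_X]
  have hg0 : g ≠ 0 := by
    intro h
    have := heval (fun _ => 1)
    rw [h, map_zero] at this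
    norm_num at this
  have hdeg : g.totalDegree = 2 := hhom.totalDegree hg0
  have hF : (fun _ : Fin 3 => (1 : MvPolynomial (Fin 4) ℂ)) =
      fun j : Fin 3 => ((fun _ : Fin 3 => (1 : Polynomial ℂ)) j).toMvPolynomial 0 := by
    funext j; simp
  have hdir : eval (fun j : Fin 3 => ((((fun _ : Fin 3 => (1 : Polynomial ℂ)) j).natDegree + 1 : ℕ) : ℂ))
      (homogeneousComponent g.totalDegree g) ≠ 0 := by
    rw [hdeg, homogeneousComponent_eq_self hhom, heval]
    simp only [Polynomial.natDegree_one]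
    norm_num
  rw [hF]
  exact polyFibredGraph_balance_member_dense g (by rw [hdeg]) _ (aeval_X_injective_fin 3) _
    (fun _ => one_ne_zero) hdir

end Examples

end Summit.Schanuel.Schanuel.Theorems

end
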